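import Summits.Ventures.Crystal3D.StickySpheres.FccLoomisWhitney
import HarnessLib

/-!
# The shadow bound for fcc clusters: `C(X) + Σ (lines meeting X) ≤ 6N`

HONEST FRAMING. Part of the venture `Summits/Ventures/Crystal3D` (cell `crystal3d-full`). An
ON-LATTICE counting inequality for the fcc packing; nothing off-lattice.

**Theorem** (`numContacts_add_sum_card_dropCoord_le`; step (L1) «run counting» of the cell's
P1-SPEC-A = `stub_latticeNoGain` for all normals, HOME/cf-p1/ROUTE.md §33).  Let `x : Fin N → ℝ³` be a
unit packing on the fcc lattice with integer coordinates `x i = barlowPos 1 √(2/3) constHagg (kf i)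
(pf i) (qf i)`, and let `ψ₁ = (pf, qf + kf, −kf)`, `ψ₂ = (kf + pf + qf, pf + qf, −qf)` be the two
unimodular charts of `FccLoomisWhitney.lean` (their six coordinate directions are the six bond-line
classes `⟨110⟩` of the lattice).  Then
`numContacts x + Σ_{d<3} |π_d(ψ₁ X)| + Σ_{d<3} |π_d(ψ₂ X)| ≤ 6N`,
i.e. the contact deficiency `6N − C` is at least the total number of bond lines (in all six
directions) that meet the cluster: every such line carries at least one run, and each run has two
broken bond slots at its ends.  Proof: `2C + #∂ψ₁ + #∂ψ₂ ≤ 12N` (every contact is a unit step of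
one chart; slot count `sum_card_stepNeighbors_add_card_boundaryPairs`) and the tree's
`two_mul_sum_card_dropCoord_le_card_boundaryPairs` (`#∂ ≥ 2 Σ_d |π_d|`).

With the affine disc count (`AffineDiscCount.lean`) applied to the lines through the mid-plane of a
slab sample this is the route to `LatticeNoGain` at a general normal (steps (L2), (L3) of the spec;
not done here); `FccCubeFacetNoGain.lean` / `BarlowAxisNoGain.lean` are the `(100)` / `(111)` cases.

WHAT THIS IS NOT: no sample, no asymptotics; rung F-C1 not moved.
-/

noncomputable section

namespace Summit.Ventures.Crystal3D

open Finset
open Literature.Probability.LatticeModels (Site unitStep boundaryPairs dropCoord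
  two_mul_sum_card_dropCoord_le_card_boundaryPairs)
open Literature.MathematicalPhysics.StatisticalMechanics (barlowPos constHagg haggLabel_const
  dist_barlowPos_eq_iff_form)

/-- **Shadow bound.** For a unit packing on the fcc lattice with integer coordinates `(kf, pf, qf)`:
`numContacts x + Σ_d |π_d ψ₁X| + Σ_d |π_d ψ₂X| ≤ 6N`, where `ψ₁X`, `ψ₂X` are the images of the
cluster in the two charts and `π_d` forgets coordinate `d` (so `|π_d ψX|` counts the bond lines of
one of the six `⟨110⟩` classes meeting the cluster). -/
theorem numContacts_add_sum_card_dropCoord_le {N : ℕ}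
    (x : Fin N → EuclideanSpace ℝ (Fin 3)) (hx : IsUnitPacking x) (kf pf qf : Fin N → ℤ)
    (hc : ∀ i, x i = barlowPos 1 (Real.sqrt (2 / 3)) constHagg (kf i) (pf i) (qf i)) :
    numContacts x +
      ∑ d : Fin 3, (dropCoord d (univ.image fun i => (![pf i, qf i + kf i, -kf i] : Site 3))).card +
      ∑ d : Fin 3, (dropCoord d (univ.image fun i =>
        (![kf i + pf i + qf i, pf i + qf i, -qf i] : Site 3))).card ≤ 6 * N := by
  classical
  have hh : (Real.sqrt (2 / 3)) ^ 2 = 2 / 3 * (1 : ℝ) ^ 2 := by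
    rw [Real.sq_sqrt (by norm_num)]; ring
  set a₁ : Fin N → Site 3 := fun i => ![pf i, qf i + kf i, -kf i] with ha₁
  set a₂ : Fin N → Site 3 := fun i => ![kf i + pf i + qf i, pf i + qf i, -qf i] with ha₂
  have hinjx := hx.injective
  have hcoord_inj : ∀ i j, kf i = kf j → pf i = pf j → qf i = qf j → i = j := by
    intro i j h1 h2 h3
    apply hinjx; rw [hc i, hc j, h1, h2, h3]
  have ha₁inj : Function.Injective a₁ := by
    intro i j h
    have h0 := congrFun h 0; have h1 := congrFun h 1; have h2 := congrFun h 2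
    simp only [ha₁, Matrix.cons_val_zero, Matrix.cons_val_one, Matrix.cons_val] at h0 h1 h2
    exact hcoord_inj i j (by omega) h0 (by omega)
  have ha₂inj : Function.Injective a₂ := by
    intro i j h
    have h0 := congrFun h 0; have h1 := congrFun h 1; have h2 := congrFun h 2
    simp only [ha₂, Matrix.cons_val_zero, Matrix.cons_val_one, Matrix.cons_val] at h0 h1 h2
    exact hcoord_inj i j (by omega) (by omega) (by omega)
  -- every contact is a unit step in one of the two charts
  have hstep : ∀ i j, dist (x i) (x j) = 1 →
      (∃ d : Fin 3, ∃ b : Bool, a₁ j = a₁ i + unitStep d b) ∨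
        (∃ d : Fin 3, ∃ b : Bool, a₂ j = a₂ i + unitStep d b) := by
    intro i j hd
    rw [dist_comm, hc j, hc i, dist_barlowPos_eq_iff_form one_pos hh constHagg,
      haggLabel_const, haggLabel_const] at hd
    rcases step_of_fccForm_eq_twelve _ _ _ hd with ⟨d, b, h⟩ | ⟨d, b, h⟩
    · refine Or.inl ⟨d, b, ?_⟩
      ext l; rw [Pi.add_apply, ← congrFun h l]
      fin_cases l <;> simp [ha₁] <;> ring
    · refine Or.inr ⟨d, b, ?_⟩
      ext l; rw [Pi.add_apply, ← congrFun h l]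
      fin_cases l <;> simp [ha₂] <;> ring
  have hdeg : ∀ i, coordination x i ≤
      (univ.filter fun j => ∃ d : Fin 3, ∃ b : Bool, a₁ j = a₁ i + unitStep d b).card +
        (univ.filter fun j => ∃ d : Fin 3, ∃ b : Bool, a₂ j = a₂ i + unitStep d b).card := by
    intro i
    refine (card_le_card fun j hj => ?_).trans (card_union_le _ _)
    rw [mem_contactNeighbors] at hj
    rw [mem_union, mem_filter, mem_filter]
    rcases hstep i j hj.2 with h | h
    · exact Or.inl ⟨mem_univ _, h⟩
    · exact Or.inr ⟨mem_univ _, h⟩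
  have hslot₁ := sum_card_stepNeighbors_add_card_boundaryPairs a₁ ha₁inj
  have hslot₂ := sum_card_stepNeighbors_add_card_boundaryPairs a₂ ha₂inj
  have hhand := sum_coordination_eq x
  have hsumdeg : ∑ i, coordination x i ≤
      ∑ i, (univ.filter fun j => ∃ d : Fin 3, ∃ b : Bool, a₁ j = a₁ i + unitStep d b).card +
        ∑ i, (univ.filter fun j => ∃ d : Fin 3, ∃ b : Bool, a₂ j = a₂ i + unitStep d b).card := by
    rw [← sum_add_distrib]; exact sum_le_sum fun i _ => hdeg i
  have hLW₁ : 2 * ∑ d : Fin 3, (dropCoord d (univ.image a₁)).card ≤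
      (boundaryPairs (univ.image a₁)).card :=
    two_mul_sum_card_dropCoord_le_card_boundaryPairs (univ.image a₁)
  have hLW₂ : 2 * ∑ d : Fin 3, (dropCoord d (univ.image a₂)).card ≤
      (boundaryPairs (univ.image a₂)).card :=
    two_mul_sum_card_dropCoord_le_card_boundaryPairs (univ.image a₂)
  omega

end Summit.Ventures.Crystal3D

end
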